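import Mathlib
import Summits.Ventures.PercRepro.TriangleCapSubBandMax
import Summits.Ventures.PercRepro.TriangleCapDeepThree

/-!
# PercRepro — EVERY SUB-BAND ON `4 + (s − t)` VERTICES, EXACTLY, IN THE MAXIMUM-DEGREE SEMANTICS
(p3, gen 54; part 294)

On `4 + (s − t)` vertices (three non-neighbours of the vertex `w` of degree `s − t`, `2 t ≤ s`) the sub-band `u`
of the census — the band values of the graphs whose off-edge graph has MAXIMUM degree exactly `t − u` — is, for
every `1 ≤ u` with `3 u ≤ 2 t` and `u + 3 ≤ t`:
* `u = 1`: `{t − 2, t − 1, t}` (the `K_{2,1}`, the fresh leaf, the inside edge `{2, 3}`: `insideWitness`);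
* `2 ≤ u ≤ t/2`: the interval `[u (t − u − 1), u (t − u − 1) + twoW 3 u / 2]` — the bounds of part 293 one way,
  the deep witness family of part 282 with `c₂ + c₃ = u` (and the values of part 283 read at `D := u`) the other;
* `t/2 < u ≤ 2t/3`: the deep set of part 284.
`subband_three_all` states the three regimes in one theorem; the sub-bands of part 264 (a non-neighbour of
off-degree `t − u`) and the census sub-bands coincide on `4 + (s − t)` vertices.  Axioms: standard.
-/

namespace PercRepro

namespace TriangleCap

namespace C047

open Finset

/-- The left ends of the inside-edge witness: `t − 1` pairs at `1`, one pair at `2`. -/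
def lfIns (t i : ℕ) : ℕ := if i < t - 1 then 1 else 2

/-- The right ends of the inside-edge witness: fresh leaves for the star, the right non-neighbour `3 + (s − t)` for
the last pair (the inside edge `{2, 3 + (s − t)}`). -/
def rfIns (s t i : ℕ) : ℕ := if i < t - 1 then 3 + i else 3 + (s - t)

/-- The ends of the inside-edge witness are good (`2 ≤ t`, `2 t ≤ s`; the left part is `{0, 1, 2}`). -/
theorem goodEnds_ins (s t : ℕ) (ht : 2 ≤ t) (hs : 2 * t ≤ s) :
    GoodEnds (3 + 1 + (s - t)) 3 t (lfIns t) (rfIns s t) := by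
  refine ⟨fun i _ => ?_, fun i hi => ?_, fun i i' hi hi' h1 h2 => ?_⟩
  · unfold lfIns
    split_ifs <;> omega
  · unfold rfIns
    split_ifs <;> omega
  · unfold lfIns at h1
    unfold rfIns at h2
    split_ifs at h1 h2 <;> omega

/-- The collision count of `lfIns`: `(t − 1)(t − 2)`. -/
theorem coll_lfIns (t : ℕ) (ht : 1 ≤ t) : coll t (lfIns t) = (t - 1) * (t - 2) := by
  have h : coll t (lfIns t) = coll ((t - 1) + 1) (fun i => if i < t - 1 then (fun _ => 1) i else (fun _ => 2) (i - (t - 1))) := by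
    have e : t = (t - 1) + 1 := by omega
    conv_lhs => rw [e]
    apply coll_congr
    intro i _
    unfold lfIns
    simp only
    split_ifs <;> omega
  rw [h, coll_concat (t - 1) 1 (fun _ => 1) (fun _ => 2) (fun i _ i' _ => by simp), coll_const, coll_const,
    show t - 1 - 1 = t - 2 by omega]
  simp

/-- `rfIns` is injective below `t`: no right collision. -/
theorem coll_rfIns (s t : ℕ) (ht : 1 ≤ t) (hs : 2 * t ≤ s) : coll t (rfIns s t) = 0 := by
  apply coll_eq_zero_of_injOn
  intro i i' hi hi' h
  unfold rfIns at h
  split_ifs at h <;> omega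

/-- **THE INSIDE-EDGE WITNESS:** for `2 ≤ t`, `2 t ≤ s`, a triangle-free graph on `4 + (s − t)` vertices with `s`
edges, a vertex `w` of degree `s − t`, every off-degree `≤ t − 1`, a vertex of off-degree `t − 1`, and the band
value `2 j = 2 t`. -/
theorem insideWitness (s t : ℕ) (ht : 2 ≤ t) (hs : 2 * t ≤ s) :
    ∃ (H : SimpleGraph (Fin (3 + 1 + (s - t)))) (_ : DecidableRel H.Adj), H.CliqueFree 3 ∧
      H.edgeFinset.card = s ∧ ∃ w, deg H w + t = s ∧ (∀ v, offDeg H w v + 1 ≤ t) ∧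
        (∃ x, offDeg H w x + 1 = t) ∧
        ∑ v, deg H v * deg H v + 2 * (t * (s - t - 1)) + 2 * t = s * (s + 1) := by
  set n := 3 + 1 + (s - t) with hn
  have hn0 : 0 < n := by omega
  have hg := goodEnds_ins s t ht hs
  have hval := genWitness_missing_value n 3 s t hn0 (lfIns t) (rfIns s t) hg (by omega) (by omega) (by omega)
    (by omega)
  have hatt : ((range t).filter (fun i => rfIns s t i < 3 + (s - t))).card = t - 1 := by
    have : (range t).filter (fun i => rfIns s t i < 3 + (s - t)) = range (t - 1) := by
      ext i
      simp only [mem_filter, mem_range]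
      unfold rfIns
      constructor
      · rintro ⟨hi, hv⟩
        split_ifs at hv <;> omega
      · intro hi
        refine ⟨by omega, ?_⟩
        rw [if_pos hi]
        omega
    rw [this, card_range]
  rw [hatt, coll_lfIns t (by omega), coll_rfIns s t (by omega) hs, add_zero] at hval
  have hcls : ∀ v, v < 3 → ((range t).filter (fun i => lfIns t i = v)).card ≤ t - 1 := by
    intro v hv
    rcases (show v = 0 ∨ v = 1 ∨ v = 2 by omega) with rfl | rfl | rfl
    · rw [card_eq_zero.mpr (filter_eq_empty_iff.mpr (fun i _ h => by unfold lfIns at h; split_ifs at h))]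
      omega
    · have : (range t).filter (fun i => lfIns t i = 1) = range (t - 1) := by
        ext i
        simp only [mem_filter, mem_range]
        unfold lfIns
        constructor
        · rintro ⟨hi, hv⟩
          split_ifs at hv <;> omega
        · intro hi
          exact ⟨by omega, if_pos hi⟩
      rw [this, card_range]
    · have : (range t).filter (fun i => lfIns t i = 2) = {t - 1} := by
        ext i
        simp only [mem_filter, mem_range, mem_singleton]
        unfold lfIns
        constructor
        · rintro ⟨hi, hv⟩
          split_ifs at hv <;> omega
        · rintro rfl
          refine ⟨by omega, ?_⟩
          rw [if_neg (by omega)]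
      rw [this, card_singleton]
      omega
  refine ⟨_, inferInstance, cliqueFree_of_bipSub _ _ (bipSub_missingGraph _ _),
    card_edges_missingGraph_genWitness n 3 s t hn0 (lfIns t) (rfIns s t) hg (by omega) (by omega) (by omega),
    fin' n hn0 0, ?_, ?_, ?_, ?_⟩
  · rw [deg_missingGraph_genWitness_zero n 3 s t hn0 (lfIns t) (rfIns s t) hg (by omega) (by omega)]
    omega
  · intro v
    have hv : v = fin' n hn0 v.val := Fin.ext (by rw [fin'_val n hn0 v.val v.isLt])
    rw [hv]
    by_cases hva : v.val < 3
    · rw [offDeg_genWitness_left n 3 s t hn0 (lfIns t) (rfIns s t) hg (by omega) v.val hva]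
      have := hcls v.val hva
      omega
    · rw [offDeg_genWitness_right n 3 s t hn0 (lfIns t) (rfIns s t) hg (by omega) v.val (by omega) v.isLt]
      have : ((range t).filter (fun i => rfIns s t i = v.val)).card ≤ 1 := by
        rw [card_le_one]
        intro i hi i' hi'
        rw [mem_filter, mem_range] at hi hi'
        have h1 := hi.2
        have h2 := hi'.2
        unfold rfIns at h1 h2
        split_ifs at h1 h2 <;> omega
      omega
  · refine ⟨fin' n hn0 1, ?_⟩
    rw [offDeg_genWitness_left n 3 s t hn0 (lfIns t) (rfIns s t) hg (by omega) 1 (by omega)]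
    have : (range t).filter (fun i => lfIns t i = 1) = range (t - 1) := by
      ext i
      simp only [mem_filter, mem_range]
      unfold lfIns
      constructor
      · rintro ⟨hi, hv⟩
        split_ifs at hv <;> omega
      · intro hi
        exact ⟨by omega, if_pos hi⟩
    rw [this, card_range]
    omega
  · have e : 2 * (t - (t - 1)) + (t * (t - 1) - (t - 1) * (t - 2)) = 2 * t := by
      obtain ⟨t', rfl⟩ : ∃ t', t = t' + 2 := ⟨t - 2, by omega⟩
      have e1 : t' + 2 - (t' + 2 - 1) = 1 := by omega
      have e2 : t' + 2 - 1 = t' + 1 := by omega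
      have e3 : t' + 2 - 2 = t' := by omega
      rw [e1, e2, e3]
      have : (t' + 2) * (t' + 1) = (t' + 1) * t' + 2 * (t' + 1) := by ring
      omega
    rw [e] at hval
    exact hval

/-- `twoW 3 1 = 4` and `twoW 3 2 = 6`. -/
theorem twoW_three_small : twoW 3 1 = 4 ∧ twoW 3 2 = 6 := by
  constructor
  · unfold twoW
    rw [coll_lfRR_zero 2 1 (by norm_num)]
  · unfold twoW
    rw [coll_lfRR_zero 2 2 (by norm_num)]

/-- **THE SHALLOW SUB-BANDS ARE ATTAINED IN THE MAXIMUM-DEGREE SEMANTICS:** for `2 ≤ u`, `2 u ≤ t`, `u + 3 ≤ t`,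
`2 t ≤ s` and `u (t − u − 1) ≤ j`, `2 j ≤ 2 u (t − u − 1) + twoW 3 u`, a graph on `4 + (s − t)` vertices with maximum
off-degree exactly `t − u` and band value `2 j`. -/
theorem shallow_attained_max (s t u j : ℕ) (hu : 2 ≤ u) (hut : 2 * u ≤ t) (hD : u + 3 ≤ t) (hs : 2 * t ≤ s)
    (hlo : u * (t - u - 1) ≤ j) (hhi : 2 * j ≤ 2 * (u * (t - u - 1)) + twoW 3 u) :
    ∃ (H : SimpleGraph (Fin (3 + 1 + (s - t)))) (_ : DecidableRel H.Adj), H.CliqueFree 3 ∧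
      H.edgeFinset.card = s ∧ ∃ w, deg H w + t = s ∧ (∀ v, offDeg H w v + u ≤ t) ∧
        (∃ x, offDeg H w x + u = t) ∧
        ∑ v, deg H v * deg H v + 2 * (t * (s - t - 1)) + 2 * j = s * (s + 1) := by
  set D := t - u with hDdef
  have hD3 : 3 ≤ D := by omega
  have huD : u ≤ D := by omega
  have hid := subband_identity t u (by omega)
  rw [← hDdef] at hid
  have htw := twoW_three_eq u hu
  have hcoll := coll_lfRR_two_eq u
  have hcl := coll_le u (lfRR 2 0)
  have hu1 : u * (u - 1) ≤ u * (u + 1) := Nat.mul_le_mul_left u (by omega)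
  have hPG : u * (u + 1) = u * (u - 1) + 2 * u := by
    obtain ⟨u', rfl⟩ : ∃ u', u = u' + 1 := ⟨u - 1, by omega⟩
    rw [Nat.add_sub_cancel]
    ring
  rw [htw] at hhi
  set Q := t * (t - 1) with hQ
  set DD := D * (D - 1) with hDD
  set A := u * (t - u - 1) with hA
  set P := u * (u + 1) with hP
  set C := coll u (lfRR 2 0) with hC
  set G := u * (u - 1) with hG
  set hmin := halfColl u ((u + 1) / 2) with hhmin
  have hev : Even (Q - 2 * j - DD) := by
    rw [Nat.even_sub (by omega), Nat.even_sub (by omega)]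
    have h1 : Even Q := Nat.even_mul_pred_self t
    have h2 : Even DD := Nat.even_mul_pred_self D
    have h3 : Even (2 * j) := even_two_mul j
    tauto
  obtain ⟨y, hy⟩ := hev
  have hy2 : Q - 2 * j - DD = 2 * y := by omega
  have hlo' : hmin ≤ y := by omega
  have h2hu := two_mul_halfColl u u
  rw [Nat.sub_self, zero_mul, add_zero] at h2hu
  have hhi' : y ≤ halfColl u u + 2 * u - u := by omega
  -- the values of part 283 read at `D := u` (`u ≤ u ≤ 2 u`); `u = 2` by hand
  have hval : ∃ c₂ α β, (u + 1) / 2 ≤ c₂ ∧ c₂ ≤ u ∧ α ≤ u - c₂ ∧ α + β ≤ c₂ ∧ halfColl u c₂ + 3 * α + β = y := by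
    rcases Nat.lt_or_ge u 3 with hu2 | hu3
    · have hu2' : u = 2 := by omega
      subst hu2'
      have h1 : halfColl 2 1 = 0 := by
        have := two_mul_halfColl 2 1
        omega
      have h2 : halfColl 2 2 = 1 := by
        have := two_mul_halfColl 2 2
        omega
      have hy3 : y ≤ 3 := by
        rw [h2] at hhi'
        omega
      interval_cases y
      · exact ⟨1, 0, 0, by omega, by omega, by omega, by omega, by rw [h1]⟩
      · exact ⟨2, 0, 0, by omega, by omega, by omega, by omega, by rw [h2]⟩
      · exact ⟨2, 0, 1, by omega, by omega, by omega, by omega, by rw [h2]⟩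
      · exact ⟨2, 0, 2, by omega, by omega, by omega, by omega, by rw [h2]⟩
    · exact deep_three_values u u y hu3 le_rfl (by omega) hlo' hhi' (fun h => by omega)
  obtain ⟨c₂, α, β, hc1, hc2, hα, hαβ, hval⟩ := hval
  have h2hc := two_mul_halfColl u c₂
  set hc := halfColl u c₂ with hhc
  set CC := c₂ * (c₂ - 1) with hCC
  set KK := (u - c₂) * (u - c₂ - 1) with hKK
  obtain ⟨H, inst, hfree, hsH, w, hw, hmax, ⟨x, hxw, hx⟩, hjH⟩ :=
    deepThreeWitness s t D c₂ (u - c₂) α β hD3 (by omega) (by omega) (by omega) hα hαβ hs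
  refine ⟨H, inst, hfree, hsH, w, hw, fun v => ?_, ⟨x, ?_⟩, ?_⟩
  · have := hmax v
    omega
  · omega
  · have e : Q - (DD + CC + KK + 6 * α + 2 * β) = 2 * j := by omega
    rw [e] at hjH
    exact hjH

/-- **EVERY SUB-BAND ON `4 + (s − t)` VERTICES, EXACTLY:** for `1 ≤ u`, `3 u ≤ 2 t`, `u + 3 ≤ t`, `2 t ≤ s`, a value
`j` is the band value of a triangle-free graph on `4 + (s − t)` vertices with `s` edges, a vertex `w` of degree
`s − t` and maximum off-degree exactly `t − u` IFF either `2 u ≤ t` and `u (t − u − 1) ≤ j`,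
`2 j ≤ 2 u (t − u − 1) + twoW 3 u` (the shallow interval), or `t + 1 ≤ 2 u` and `(t − u − 1)(3 u − t) ≤ j`,
`2 j ≤ deepTop t 2 u`, `3 u = 2 t → j ≠ (t − u − 1)(3 u − t) + 1` (the deep set). -/
theorem subband_three_all (s t u j : ℕ) (hu : 1 ≤ u) (hu2 : 3 * u ≤ 2 * t) (hD : u + 3 ≤ t) (hs : 2 * t ≤ s) :
    (∃ (H : SimpleGraph (Fin (3 + 1 + (s - t)))) (_ : DecidableRel H.Adj), H.CliqueFree 3 ∧
      H.edgeFinset.card = s ∧ ∃ w, deg H w + t = s ∧ (∀ v, offDeg H w v + u ≤ t) ∧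
        (∃ x, offDeg H w x + u = t) ∧
        ∑ v, deg H v * deg H v + 2 * (t * (s - t - 1)) + 2 * j = s * (s + 1)) ↔
    ((2 * u ≤ t ∧ u * (t - u - 1) ≤ j ∧ 2 * j ≤ 2 * (u * (t - u - 1)) + twoW 3 u) ∨
      (t + 1 ≤ 2 * u ∧ (t - u - 1) * (3 * u - t) ≤ j ∧ 2 * j ≤ deepTop t 2 u ∧
        (3 * u = 2 * t → j ≠ (t - u - 1) * (3 * u - t) + 1))) := by
  rcases Nat.lt_or_ge t (2 * u) with hdeep | hshallow
  · -- the deep regime: part 284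
    have h := deep_subband_three s t u j (by omega) hu2 hD hs
    constructor
    · intro hg
      right
      exact ⟨by omega, h.mp hg⟩
    · rintro (⟨h1, -⟩ | ⟨-, h2⟩)
      · omega
      · exact h.mpr h2
  · constructor
    · rintro ⟨H, _, hfree, hsH, w, hw, hmax, ⟨x, hx⟩, hj⟩
      left
      have hℓ := card_nonNbrs_three s t H w hw
      have hw1 : 1 ≤ deg H w := by omega
      have hb := subband_bounds_max H hfree s t u j hsH w hw hw1 hj hmax x hx hu (by omega) (by omega)
      rw [hℓ] at hb
      exact ⟨hshallow, hb.1, hb.2⟩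
    · rintro (⟨-, hlo, hhi⟩ | ⟨h1, -⟩)
      · rcases Nat.lt_or_ge u 2 with hu1 | hu2'
        · -- `u = 1`: the three values `t − 2`, `t − 1`, `t`
          have hu1' : u = 1 := by omega
          subst hu1'
          rw [twoW_three_small.1] at hhi
          have hj3 : j = t - 2 ∨ j = t - 1 ∨ j = t := by omega
          rcases hj3 with hj | hj | hj <;> rw [hj]
          · obtain ⟨H, inst, hfree, hsH, w, hw, hmax, ⟨x, hxw, hx⟩, hjH⟩ :=
              deepThreeWitness s t (t - 1) 1 0 0 1 (by omega) (by omega) (by omega) (by omega) (by omega)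
                (by omega) hs
            refine ⟨H, inst, hfree, hsH, w, hw, fun v => by have := hmax v; omega, ⟨x, by omega⟩, ?_⟩
            have e : t * (t - 1) - ((t - 1) * (t - 1 - 1) + 1 * (1 - 1) + 0 * (0 - 1) + 6 * 0 + 2 * 1) =
                2 * (t - 2) := by
              obtain ⟨t', rfl⟩ : ∃ t', t = t' + 2 := ⟨t - 2, by omega⟩
              have e1 : t' + 2 - 1 = t' + 1 := by omega
              have e2 : t' + 1 - 1 = t' := by omega
              have e3 : t' + 2 - 2 = t' := by omega
              rw [e1, e2, e3]
              have : (t' + 2) * (t' + 1) = (t' + 1) * t' + 2 * (t' + 1) := by ring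
              omega
            rw [e] at hjH
            exact hjH
          · obtain ⟨H, inst, hfree, hsH, w, hw, hmax, ⟨x, hxw, hx⟩, hjH⟩ :=
              deepThreeWitness s t (t - 1) 1 0 0 0 (by omega) (by omega) (by omega) (by omega) (by omega)
                (by omega) hs
            refine ⟨H, inst, hfree, hsH, w, hw, fun v => by have := hmax v; omega, ⟨x, by omega⟩, ?_⟩
            have e : t * (t - 1) - ((t - 1) * (t - 1 - 1) + 1 * (1 - 1) + 0 * (0 - 1) + 6 * 0 + 2 * 0) =
                2 * (t - 1) := by
              obtain ⟨t', rfl⟩ : ∃ t', t = t' + 2 := ⟨t - 2, by omega⟩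
              have e1 : t' + 2 - 1 = t' + 1 := by omega
              have e2 : t' + 1 - 1 = t' := by omega
              rw [e1, e2]
              have : (t' + 2) * (t' + 1) = (t' + 1) * t' + 2 * (t' + 1) := by ring
              omega
            rw [e] at hjH
            exact hjH
          · obtain ⟨H, inst, hfree, hsH, w, hw, hmax, hx, hjH⟩ := insideWitness s t (by omega) hs
            exact ⟨H, inst, hfree, hsH, w, hw, hmax, hx, hjH⟩
        · exact shallow_attained_max s t u j hu2' hshallow hD hs hlo hhi
      · omega

end C047

end TriangleCap

end PercRepro
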